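import Mathlib
import HarnessLib
import Summits.HubbardSuperconductivity.HubbardSuperconductivity.Theorems.ChiralWindowDefsResidual
import Summits.HubbardSuperconductivity.HubbardSuperconductivity.Theorems.ChiralWindowCwKLChiralWindowCoverLogic

/-!
# Crux `CwKLChiralWindow` (stmt-1741), line `Sketch`: the cover logic of the residual-form checker (F5R)

Pure combinatorics of `KLCert.checkR` (`Theorems/ChiralWindowDefsResidual.lean`), the residual-form companion of
`stub_klCoverLogic` (`Theorems/ChiralWindowCwKLChiralWindowCoverLogic.lean`): if the residual-form checker accepts
the record `c` then the window ends and constants are in range, every box passes `basicOKR`/`isolationOKR`/`nodeOKR`,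
every real `μ ∈ [μ_b, μ_a]` lies in some box (the boxes are contiguous — `chainOK`, unchanged — from a box starting
below `μ_b` to a box ending above `μ_a`; the chain cover `kl_cvl_chain_cover` is reused), and the two `any` clauses
give a box containing `μ_a` with `b1gLeadsOKR` and a box containing `μ_b` with `eLeadsOKR` (`stub_klCoverLogicR`).
-/

noncomputable section

set_option linter.dupNamespace false

namespace Summit.HubbardSuperconductivity.HubbardSuperconductivity.Theorems

open MeasureTheory Literature.MathematicalPhysics.QuantumLattice CwKLChiralWindow

/-- **Cover logic, residual form (F5R).** What `KLCert.checkR = true` says, unpacked: the window ends and constants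
are in range, every box passes `basicOKR`, `isolationOKR` and `nodeOKR`, every `μ ∈ [μ_b, μ_a]` lies in some box (the
boxes are contiguous from below `μ_b` to above `μ_a`), some box containing `μ_a` passes `b1gLeadsOKR` and some box
containing `μ_b` passes `eLeadsOKR`. [folklore] -/
theorem stub_klCoverLogicR : ∀ c : KLCert, c.checkR = true →
    (-4 < c.mub ∧ c.mub < c.mua ∧ c.mua < 0 ∧ 0 < c.gamma ∧ 0 < c.cov) ∧
    (∀ bx ∈ c.boxes, bx.basicOKR c.trials = true ∧ bx.isolationOKR c.trials c.gamma = true ∧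
      bx.nodeOKR c.trials c.cov = true) ∧
    (∀ μ : ℝ, ((c.mub : ℚ) : ℝ) ≤ μ → μ ≤ ((c.mua : ℚ) : ℝ) →
      ∃ bx ∈ c.boxes, ((bx.mulo : ℚ) : ℝ) ≤ μ ∧ μ ≤ ((bx.muhi : ℚ) : ℝ)) ∧
    (∃ bx ∈ c.boxes, bx.mulo ≤ c.mua ∧ c.mua ≤ bx.muhi ∧ bx.b1gLeadsOKR c.trials c.gamma = true) ∧
    (∃ bx ∈ c.boxes, bx.mulo ≤ c.mub ∧ c.mub ≤ bx.muhi ∧ bx.eLeadsOKR c.trials c.gamma = true) := by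
  intro c hc
  unfold KLCert.checkR at hc
  simp only [Bool.and_eq_true, decide_eq_true_eq] at hc
  obtain ⟨⟨⟨⟨⟨⟨⟨⟨⟨h₁, h₂⟩, h₃⟩, h₄⟩, h₅⟩, hmatch⟩, hchain⟩, hall⟩, hany₁⟩, hany₂⟩ := hc
  refine ⟨⟨h₁, h₂, h₃, h₄, h₅⟩, ?_, ?_, ?_, ?_⟩
  · intro bx hbx
    have h := List.all_eq_true.1 hall bx hbx
    simp only [Bool.and_eq_true] at h
    exact ⟨h.1.1, h.1.2, h.2⟩
  · intro μ hμ₁ hμ₂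
    split at hmatch
    · rename_i b₀ b₁ hb₀ hb₁
      simp only [Bool.and_eq_true, decide_eq_true_eq] at hmatch
      obtain ⟨L, hL⟩ := List.head?_eq_some_iff.1 hb₀
      rw [hL] at hchain hb₁ ⊢
      have hlo : ((b₀.mulo : ℚ) : ℝ) ≤ μ := le_trans (by exact_mod_cast hmatch.1) hμ₁
      have hhi : μ ≤ ((b₁.muhi : ℚ) : ℝ) := le_trans hμ₂ (by exact_mod_cast hmatch.2)
      exact kl_cvl_chain_cover L b₀ b₁ hchain hb₁ μ hlo hhi
    · exact absurd hmatch Bool.false_ne_true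
  · obtain ⟨bx, hbx, h⟩ := List.any_eq_true.1 hany₁
    simp only [Bool.and_eq_true, decide_eq_true_eq] at h
    exact ⟨bx, hbx, h.1.1, h.1.2, h.2⟩
  · obtain ⟨bx, hbx, h⟩ := List.any_eq_true.1 hany₂
    simp only [Bool.and_eq_true, decide_eq_true_eq] at h
    exact ⟨bx, hbx, h.1.1, h.1.2, h.2⟩

end Summit.HubbardSuperconductivity.HubbardSuperconductivity.Theorems

end
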